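import Mathlib
import Literature.Analysis.ODE.SchrodingerODE
import HarnessLib

/-!
# The recessive solution of `u'' = V u` at `−∞` for a small integrable potential (Volterra method)
# — file `VolterraRecessive.lean` (the file `RecessiveSolution.lean` of this directory treats the
# opposite regime `re Q ≥ γ² > 0` at `+∞`)

Analysis/ODE support file (everything proved, no definitions). Let `V ≥ 0` be continuous on `ℝ` and
small on a left half-line `(−∞, A]` in the Volterra sense:
`V` and `y ↦ (A − y) V(y)` are integrable on `(−∞, A]` and `Q := ∫_{−∞}^A (A − y) V(y) dy ≤ 1/2`.
Then the integral equation

  `u(x) = 1 + ∫_{−∞}^x (x − y) V(y) u(y) dy`      (`x ≤ A`)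

has a solution (`exists_volterra_recessiveSolution`): a continuous function `u : ℝ → ℝ` with `|u| ≤ 2`,
satisfying the equation on `(−∞, A]`, hence `|u − 1| ≤ 2Q` there, of class `C²` on `(−∞, A)` with
`u'(x) = ∫_{−∞}^x V u` (so `|u'(x)| ≤ 2∫_{−∞}^x V → 0`) and `u'' = V u`. This is the solution of the
Schrödinger-type equation `u'' = Vu` that is RECESSIVE (bounded, `u → 1`, `u' → 0`) at `−∞`; its
existence for `∫ |y| V < ∞` is classical (Volterra series / successive approximations, e.g.
P. Hartman, *Ordinary Differential Equations*, Ch. XI §9; M. Reed–B. Simon III, Thm. XI.57 (Jost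
solutions)). Proof here: the map `f ↦ 1 + ∫_{−∞}^{min(x,A)} (min(x,A) − y) V f` is a `Q`-contraction
of the Banach space of bounded continuous functions on `ℝ` (`BoundedContinuousFunction`), and the
fixed point is differentiated with the fundamental theorem of calculus.

`exists_isSchrodingerSol_recessive` then extends it to a GLOBAL classical solution
(`IsSchrodingerSol V U`, `SchrodingerODE.lean`: global existence + uniqueness on `(−∞, A)`) that
agrees with the Volterra solution on `(−∞, A)`.

Use: the finite-energy static solution spanning the horizon-side t-polynomial kernel of the
Regge–Wheeler channel items (route PhotonSphereChannels, `FixedModeChannels`,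
stmt-FinalStateConjecture-10048), where `V` is the exponentially small tail of the potential.
-/

noncomputable section

namespace Literature.Analysis.ODE

open MeasureTheory Set Filter Topology intervalIntegral BoundedContinuousFunction

variable {V : ℝ → ℝ} {A : ℝ}

/-- Weighted tail integrals are monotone: for `m ≤ A` and a function `φ` with `|φ| ≤ C` on `ℝ`,
`|∫_{−∞}^m (m − y) V(y) φ(y) dy| ≤ C · ∫_{−∞}^A (A − y) V(y) dy` (`V ≥ 0` continuous, `(A − y)V`
integrable on `(−∞, A]`, `φ` continuous). [folklore] -/
theorem abs_setIntegral_Iic_weight_mul_le (hV0 : ∀ x, 0 ≤ V x)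
    (hW : IntegrableOn (fun y => (A - y) * V y) (Iic A)) (hVi : IntegrableOn V (Iic A))
    {φ : ℝ → ℝ} (hφ : Continuous φ) {C : ℝ} (hC : ∀ y, |φ y| ≤ C) {m : ℝ} (hm : m ≤ A) :
    |∫ y in Iic m, (m - y) * V y * φ y| ≤ C * ∫ y in Iic A, (A - y) * V y := by
  have hC0 : 0 ≤ C := (abs_nonneg _).trans (hC 0)
  -- integrability of the weight on `Iic m`
  have hWm : IntegrableOn (fun y => (m - y) * V y) (Iic m) := by
    have h1 : IntegrableOn (fun y => (A - y) * V y) (Iic m) := hW.mono_set (Iic_subset_Iic.2 hm)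
    have h2 : IntegrableOn (fun y => (A - m) * V y) (Iic m) :=
      (hVi.mono_set (Iic_subset_Iic.2 hm)).const_mul _
    have : (fun y => (m - y) * V y) = fun y => (A - y) * V y - (A - m) * V y := by
      funext y; ring
    rw [this]
    exact h1.sub h2
  have hWφ : IntegrableOn (fun y => (m - y) * V y * φ y) (Iic m) := by
    have : (fun y => (m - y) * V y * φ y) = fun y => φ y * ((m - y) * V y) := by funext y; ring
    rw [this]
    exact Integrable.bdd_mul hWm hφ.aestronglyMeasurable (Eventually.of_forall fun y => by
      rw [Real.norm_eq_abs]; exact hC y)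
  calc |∫ y in Iic m, (m - y) * V y * φ y|
      ≤ ∫ y in Iic m, |(m - y) * V y * φ y| := abs_integral_le_integral_abs
    _ ≤ ∫ y in Iic m, C * ((m - y) * V y) := by
        refine setIntegral_mono_on hWφ.abs (hWm.const_mul C) measurableSet_Iic fun y hy => ?_
        have hmy : 0 ≤ m - y := by simp only [mem_Iic] at hy; linarith
        rw [abs_mul, abs_of_nonneg (mul_nonneg hmy (hV0 y))]
        nlinarith [hC y, hV0 y, mul_nonneg hmy (hV0 y)]
    _ = C * ∫ y in Iic m, (m - y) * V y := MeasureTheory.integral_const_mul _ _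
    _ ≤ C * ∫ y in Iic A, (A - y) * V y := by
        refine mul_le_mul_of_nonneg_left ?_ hC0
        calc (∫ y in Iic m, (m - y) * V y) ≤ ∫ y in Iic m, (A - y) * V y :=
              setIntegral_mono_on hWm (hW.mono_set (Iic_subset_Iic.2 hm)) measurableSet_Iic
                fun y _ => mul_le_mul_of_nonneg_right (by linarith) (hV0 y)
          _ ≤ ∫ y in Iic A, (A - y) * V y :=
              setIntegral_mono_set hW
                (ae_restrict_of_forall_mem measurableSet_Iic fun y hy =>
                  mul_nonneg (sub_nonneg.2 hy) (hV0 y))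
                (Eventually.of_forall (Iic_subset_Iic.2 hm))

/-- **The recessive solution at `−∞` (Volterra).** Let `V ≥ 0` be continuous with `V` and
`(A − y)V(y)` integrable on `(−∞, A]` and `∫_{−∞}^A (A − y)V(y) dy ≤ 1/2`. Then there is a continuous
`u : ℝ → ℝ` with `|u| ≤ 2` on `ℝ` such that
* `u(x) = 1 + ∫_{−∞}^x (x − y)V(y)u(y) dy` for `x ≤ A` (so `|u(x) − 1| ≤ 2∫_{−∞}^A (A−y)V`),
* `u` is `C²` on `(−∞, A)` with `u'(x) = ∫_{−∞}^x V u` and `(u')' (x) = V(x)u(x)` there,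
* `|∫_{−∞}^x V u| ≤ 2∫_{−∞}^x V` for `x ≤ A`.
[folklore] -/
theorem exists_volterra_recessiveSolution (hV : Continuous V) (hV0 : ∀ x, 0 ≤ V x)
    (hVi : IntegrableOn V (Iic A)) (hW : IntegrableOn (fun y => (A - y) * V y) (Iic A))
    (hQ : ∫ y in Iic A, (A - y) * V y ≤ 1 / 2) :
    ∃ u : ℝ → ℝ, Continuous u ∧ (∀ x, |u x| ≤ 2) ∧
      (∀ x ≤ A, u x = 1 + ∫ y in Iic x, (x - y) * V y * u y) ∧
      (∀ x ≤ A, |u x - 1| ≤ 2 * ∫ y in Iic A, (A - y) * V y) ∧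
      ContDiffOn ℝ 2 u (Iio A) ∧
      (∀ x < A, HasDerivAt u (∫ y in Iic x, V y * u y) x) ∧
      (∀ x, HasDerivAt (fun x => ∫ y in Iic x, V y * u y) (V x * u x) x) ∧
      (∀ x ≤ A, |∫ y in Iic x, V y * u y| ≤ 2 * ∫ y in Iic x, V y) := by
  set Q : ℝ := ∫ y in Iic A, (A - y) * V y with hQdef
  have hQ0 : 0 ≤ Q :=
    setIntegral_nonneg measurableSet_Iic fun y hy => mul_nonneg (sub_nonneg.2 hy) (hV0 y)
  have hQ1 : Q < 1 := by linarith
  -- the Volterra operator, frozen at `A`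
  set m : ℝ → ℝ := fun x => min x A with hm
  have hm_le : ∀ x, m x ≤ A := fun x => min_le_right _ _
  have hm_cont : Continuous m := continuous_id.min continuous_const
  set Top : (ℝ → ℝ) → ℝ → ℝ := fun f x => 1 + ∫ y in Iic (m x), (m x - y) * V y * f y with hTop
  -- integrability helpers
  have hyV : IntegrableOn (fun y => y * V y) (Iic A) := by
    have : (fun y => y * V y) = fun y => A * V y - (A - y) * V y := by funext y; ring
    rw [this]; exact (hVi.const_mul A).sub hW
  have hint_bdd : ∀ {φ : ℝ → ℝ}, Continuous φ → ∀ C, (∀ y, |φ y| ≤ C) → ∀ {k : ℝ → ℝ} {b : ℝ},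
      IntegrableOn k (Iic A) → b ≤ A → IntegrableOn (fun y => k y * φ y) (Iic b) := by
    intro φ hφ C hC k b hk hb
    have : (fun y => k y * φ y) = fun y => φ y * k y := by funext y; ring
    rw [this]
    exact Integrable.bdd_mul (hk.mono_set (Iic_subset_Iic.2 hb)) hφ.aestronglyMeasurable
      (Eventually.of_forall fun y => by rw [Real.norm_eq_abs]; exact hC y)
  -- continuity and the explicit split of the Volterra integral
  have hsplit : ∀ {φ : ℝ → ℝ}, Continuous φ → ∀ C, (∀ y, |φ y| ≤ C) → ∀ b ≤ A,
      (∫ y in Iic b, (b - y) * V y * φ y)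
        = b * (∫ y in Iic b, V y * φ y) - ∫ y in Iic b, y * V y * φ y := by
    intro φ hφ C hC b hb
    have i1 : IntegrableOn (fun y => V y * φ y) (Iic b) := hint_bdd hφ C hC hVi hb
    have i2 : IntegrableOn (fun y => y * V y * φ y) (Iic b) := hint_bdd hφ C hC hyV hb
    have : (fun y => (b - y) * V y * φ y) = fun y => b * (V y * φ y) - y * V y * φ y := by
      funext y; ring
    rw [this, integral_sub (i1.const_mul b) i2, MeasureTheory.integral_const_mul]
  have hprim : ∀ {k : ℝ → ℝ}, Continuous k → IntegrableOn k (Iic A) →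
      Continuous fun x => ∫ y in Iic (m x), k y := by
    intro k hk hki
    have heq : (fun x => ∫ y in Iic (m x), k y) = fun x => (∫ y in Iic A, k y) - ∫ y in (m x)..A, k y := by
      funext x
      have := integral_Iic_sub_Iic (hki.mono_set (Iic_subset_Iic.2 (hm_le x))) hki
      linarith
    rw [heq]
    refine continuous_const.sub ?_
    have hc := (intervalIntegral.continuous_primitive (μ := volume)
      (fun a b => hk.intervalIntegrable a b) A).comp hm_cont
    have : (fun x => ∫ y in (m x)..A, k y) = fun x => -((fun b => ∫ y in A..b, k y) ∘ m) x := by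
      funext x; simp [integral_symm A (m x)]
    rw [this]
    exact hc.neg
  have hTop_cont : ∀ {φ : ℝ → ℝ}, Continuous φ → ∀ C, (∀ y, |φ y| ≤ C) → Continuous (Top φ) := by
    intro φ hφ C hC
    have heq : Top φ = fun x => 1 + (m x * (∫ y in Iic (m x), V y * φ y)
        - ∫ y in Iic (m x), y * V y * φ y) := by
      funext x; simp only [hTop]; rw [hsplit hφ C hC (m x) (hm_le x)]
    rw [heq]
    refine continuous_const.add ((hm_cont.mul ?_).sub ?_)
    · exact hprim (hV.mul hφ) (hint_bdd hφ C hC hVi le_rfl)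
    · exact hprim ((continuous_id.mul hV).mul hφ) (by
        have := hint_bdd hφ C hC hyV le_rfl
        simpa [mul_assoc] using this)
  have hTop_bound : ∀ {φ : ℝ → ℝ}, Continuous φ → ∀ C, (∀ y, |φ y| ≤ C) → ∀ x,
      |Top φ x - 1| ≤ C * Q := by
    intro φ hφ C hC x
    simp only [hTop, add_sub_cancel_left]
    exact abs_setIntegral_Iic_weight_mul_le hV0 hW hVi hφ hC (hm_le x)
  -- integrability of the shifted weights and of products with bounded functions
  have hWb : ∀ b ≤ A, IntegrableOn (fun y => (b - y) * V y) (Iic A) := by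
    intro b hb
    have : (fun y => (b - y) * V y) = fun y => (A - y) * V y - (A - b) * V y := by funext y; ring
    rw [this]; exact hW.sub (hVi.const_mul _)
  -- the operator on bounded continuous functions
  have hnorm_abs : ∀ (f : ℝ →ᵇ ℝ) (y : ℝ), |f y| ≤ ‖f‖ := fun f y => by
    rw [← Real.norm_eq_abs]; exact f.norm_coe_le_norm y
  have hT_bd : ∀ f : ℝ →ᵇ ℝ, ∀ x, ‖Top f x‖ ≤ 1 + ‖f‖ * Q := fun f x => by
    have h := hTop_bound f.continuous ‖f‖ (hnorm_abs f) x
    rw [Real.norm_eq_abs]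
    have : |Top f x| ≤ |Top f x - 1| + |(1 : ℝ)| := by
      have := abs_add_le (Top f x - 1) 1; simpa only [sub_add_cancel] using this
    rw [abs_one] at this
    linarith
  set T : (ℝ →ᵇ ℝ) → (ℝ →ᵇ ℝ) := fun f =>
    BoundedContinuousFunction.ofNormedAddCommGroup (Top f)
      (hTop_cont f.continuous ‖f‖ (hnorm_abs f)) (1 + ‖f‖ * Q) (hT_bd f) with hT
  have hT_apply : ∀ (f : ℝ →ᵇ ℝ) (x : ℝ), T f x = Top f x := fun f x => rfl
  have hT_norm : ∀ f : ℝ →ᵇ ℝ, ‖T f‖ ≤ 1 + ‖f‖ * Q := fun f =>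
    BoundedContinuousFunction.norm_ofNormedAddCommGroup_le _
      (add_nonneg zero_le_one (mul_nonneg (norm_nonneg _) hQ0)) _
  have hK : ((Q.toNNReal : NNReal) : ℝ) = Q := Real.coe_toNNReal Q hQ0
  have hT_contr : ContractingWith Q.toNNReal T := by
    refine ⟨NNReal.coe_lt_coe.1 (by rw [hK, NNReal.coe_one]; exact hQ1),
      LipschitzWith.of_dist_le_mul fun f g => ?_⟩
    rw [hK, dist_le (mul_nonneg hQ0 dist_nonneg)]
    intro x
    rw [hT_apply, hT_apply, Real.dist_eq]
    have i1 : IntegrableOn (fun y => (m x - y) * V y * f y) (Iic (m x)) :=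
      hint_bdd f.continuous ‖f‖ (hnorm_abs f) (hWb (m x) (hm_le x)) (hm_le x)
    have i2 : IntegrableOn (fun y => (m x - y) * V y * g y) (Iic (m x)) :=
      hint_bdd g.continuous ‖g‖ (hnorm_abs g) (hWb (m x) (hm_le x)) (hm_le x)
    have hdiff : Top f x - Top g x = ∫ y in Iic (m x), (m x - y) * V y * (f y - g y) := by
      simp only [hTop, add_sub_add_left_eq_sub]
      rw [← integral_sub i1 i2]
      refine integral_congr_ae (Eventually.of_forall fun y => ?_)
      show (m x - y) * V y * f y - (m x - y) * V y * g y = (m x - y) * V y * (f y - g y)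
      ring
    rw [hdiff]
    have hφ : Continuous fun y => f y - g y := f.continuous.sub g.continuous
    have hC : ∀ y, |f y - g y| ≤ dist f g := fun y => by
      rw [← Real.dist_eq]; exact dist_coe_le_dist y
    have := abs_setIntegral_Iic_weight_mul_le hV0 hW hVi hφ hC (hm_le x)
    simpa [hQdef, mul_comm] using this
  -- the fixed point
  set u₀ : ℝ →ᵇ ℝ := ContractingWith.fixedPoint T hT_contr with hu₀
  have hfix₀ : T u₀ = u₀ := hT_contr.fixedPoint_isFixedPt
  set u : ℝ → ℝ := fun x => u₀ x with hu
  have hcont : Continuous u := u₀.continuous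
  have hfix : ∀ x, u x = Top u x := fun x => by
    have h := congrArg (fun h : ℝ →ᵇ ℝ => h x) hfix₀
    simpa [hT_apply] using h.symm
  have hnorm : ‖u₀‖ ≤ 2 := by
    have h := hT_norm u₀
    rw [hfix₀] at h
    nlinarith [norm_nonneg u₀]
  have habs : ∀ x, |u x| ≤ 2 := fun x => (hnorm_abs u₀ x).trans hnorm
  -- integral equation and closeness to `1` on `(−∞, A]`
  have heq : ∀ x ≤ A, u x = 1 + ∫ y in Iic x, (x - y) * V y * u y := by
    intro x hx
    have h := hfix x
    simp only [hTop, hm, min_eq_left hx] at h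
    exact h
  have hclose : ∀ x ≤ A, |u x - 1| ≤ 2 * Q := by
    intro x hx
    rw [heq x hx, add_sub_cancel_left]
    exact abs_setIntegral_Iic_weight_mul_le hV0 hW hVi hcont habs hx
  -- the primitives `P x = ∫_{−∞}^x V u` and `R x = ∫_{−∞}^x y V u`
  have hInt_all : ∀ {k : ℝ → ℝ}, Continuous k → IntegrableOn k (Iic A) → ∀ x,
      IntegrableOn k (Iic x) := by
    intro k hk hki x
    rcases le_or_gt x A with hx | hx
    · exact hki.mono_set (Iic_subset_Iic.2 hx)
    · have : Iic x = Iic A ∪ Icc A x := by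
        ext y; simp only [mem_Iic, mem_union, mem_Icc]
        constructor
        · intro hy; rcases le_or_gt y A with h | h
          · left; exact h
          · right; exact ⟨h.le, hy⟩
        · rintro (h | h)
          · linarith
          · exact h.2
      rw [this]
      exact hki.union hk.integrableOn_Icc
  have hVu_c : Continuous fun y => V y * u y := hV.mul hcont
  have hyVu_c : Continuous fun y => y * V y * u y := (continuous_id.mul hV).mul hcont
  have hVu_i : IntegrableOn (fun y => V y * u y) (Iic A) := hint_bdd hcont 2 habs hVi le_rfl
  have hyVu_i : IntegrableOn (fun y => y * V y * u y) (Iic A) := hint_bdd hcont 2 habs hyV le_rfl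
  have hFTC : ∀ {k : ℝ → ℝ}, Continuous k → IntegrableOn k (Iic A) → ∀ x,
      HasDerivAt (fun x => ∫ y in Iic x, k y) (k x) x := by
    intro k hk hki x
    have heq' : (fun x => ∫ y in Iic x, k y) = fun x => (∫ y in Iic A, k y) + ∫ y in A..x, k y := by
      funext z
      have := integral_Iic_sub_Iic hki (hInt_all hk hki z)
      linarith
    rw [heq']
    exact (intervalIntegral.integral_hasDerivAt_right (hk.intervalIntegrable _ _)
      (hk.stronglyMeasurableAtFilter _ _) hk.continuousAt).const_add _
  have hP : ∀ x, HasDerivAt (fun x => ∫ y in Iic x, V y * u y) (V x * u x) x := hFTC hVu_c hVu_i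
  have hR : ∀ x, HasDerivAt (fun x => ∫ y in Iic x, y * V y * u y) (x * V x * u x) x :=
    hFTC hyVu_c hyVu_i
  -- `u = 1 + x P − R` on `(−∞, A]`, hence differentiable on `(−∞, A)` with `u' = P`
  set G : ℝ → ℝ := fun x => 1 + x * (∫ y in Iic x, V y * u y) - ∫ y in Iic x, y * V y * u y with hG
  have huG : ∀ x ≤ A, u x = G x := by
    intro x hx
    rw [heq x hx, hG, hsplit hcont 2 habs x hx]
    ring
  have hGd : ∀ x, HasDerivAt G (∫ y in Iic x, V y * u y) x := by
    intro x
    have h := (((hasDerivAt_id x).mul (hP x)).const_add 1).sub (hR x)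
    refine h.congr_deriv ?_
    simp only [id]
    ring
  have hderiv : ∀ x < A, HasDerivAt u (∫ y in Iic x, V y * u y) x := by
    intro x hx
    refine (hGd x).congr_of_eventuallyEq ?_
    exact Filter.mem_of_superset (Iio_mem_nhds hx) fun z hz => huG z (le_of_lt hz)
  -- `C²` on `(−∞, A)`
  have hC2 : ContDiffOn ℝ 2 u (Iio A) := by
    have hPC1 : ContDiffOn ℝ 1 (fun x => ∫ y in Iic x, V y * u y) (Iio A) := by
      rw [show (1 : WithTop ℕ∞) = 0 + 1 by norm_num,
        contDiffOn_succ_iff_deriv_of_isOpen isOpen_Iio]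
      refine ⟨fun x _ => (hP x).differentiableAt.differentiableWithinAt, fun h => absurd h (by simp),
        ?_⟩
      have : deriv (fun x => ∫ y in Iic x, V y * u y) = fun x => V x * u x :=
        funext fun x => (hP x).deriv
      rw [this]
      exact contDiffOn_zero.2 hVu_c.continuousOn
    rw [show (2 : WithTop ℕ∞) = 1 + 1 by norm_num, contDiffOn_succ_iff_deriv_of_isOpen isOpen_Iio]
    refine ⟨fun x hx => (hderiv x hx).differentiableAt.differentiableWithinAt,
      fun h => absurd h (by simp), ?_⟩
    exact hPC1.congr fun x hx => (hderiv x hx).deriv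
  -- the derivative bound
  have hPbd : ∀ x ≤ A, |∫ y in Iic x, V y * u y| ≤ 2 * ∫ y in Iic x, V y := by
    intro x hx
    have hVx : IntegrableOn V (Iic x) := hVi.mono_set (Iic_subset_Iic.2 hx)
    calc |∫ y in Iic x, V y * u y| ≤ ∫ y in Iic x, |V y * u y| := abs_integral_le_integral_abs
      _ ≤ ∫ y in Iic x, 2 * V y := by
          refine setIntegral_mono_on (hVu_i.mono_set (Iic_subset_Iic.2 hx)).abs (hVx.const_mul 2)
            measurableSet_Iic fun y _ => ?_
          rw [abs_mul, abs_of_nonneg (hV0 y)]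
          nlinarith [habs y, hV0 y]
      _ = 2 * ∫ y in Iic x, V y := MeasureTheory.integral_const_mul _ _
  exact ⟨u, hcont, habs, heq, hclose, hC2, hderiv, hP, hPbd⟩

/-- **Global recessive solution.** Under the hypotheses of `exists_volterra_recessiveSolution` there is
a global classical solution `U` of `U'' = V U` on `ℝ` (`IsSchrodingerSol V U`) which on `(−∞, A)`
is the Volterra solution: `|U| ≤ 2`, `|U − 1| ≤ 2∫_{−∞}^A (A−y)V`, `U' x = ∫_{−∞}^x V U` and
`|U' x| ≤ 2∫_{−∞}^x V` there. (Global existence from any point of `(−∞, A)` and uniqueness of the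
phase curve on `(−∞, A)`.) [folklore] -/
theorem exists_isSchrodingerSol_recessive (hV : Continuous V) (hV0 : ∀ x, 0 ≤ V x)
    (hVi : IntegrableOn V (Iic A)) (hW : IntegrableOn (fun y => (A - y) * V y) (Iic A))
    (hQ : ∫ y in Iic A, (A - y) * V y ≤ 1 / 2) :
    ∃ U : ℝ → ℝ, IsSchrodingerSol V U ∧
      (∀ x < A, |U x| ≤ 2) ∧
      (∀ x < A, |U x - 1| ≤ 2 * ∫ y in Iic A, (A - y) * V y) ∧
      (∀ x < A, deriv U x = ∫ y in Iic x, V y * U y) ∧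
      (∀ x < A, |deriv U x| ≤ 2 * ∫ y in Iic x, V y) := by
  obtain ⟨u, hcont, habs, -, hclose, -, hderiv, hP, hPbd⟩ :=
    exists_volterra_recessiveSolution hV hV0 hVi hW hQ
  -- global solution through the data of `u` at `A - 1`
  obtain ⟨U, hU, hU0, hU1⟩ := exists_isSchrodingerSol hV (A - 1) (u (A - 1))
    (∫ y in Iic (A - 1), V y * u y)
  -- uniqueness of the phase curve on `(−∞, A)`
  have hEq : ∀ x < A, u x = U x ∧ (∫ y in Iic x, V y * u y) = deriv U x := by
    intro x hx
    set a : ℝ := min x (A - 1) - 1 with ha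
    have hax : a < x := by simp only [ha]; linarith [min_le_left x (A - 1)]
    have haA : a < A - 1 := by simp only [ha]; linarith [min_le_right x (A - 1)]
    obtain ⟨K, -, -, hK⟩ := exists_const_schrodingerField hV a A
    have key := ODE_solution_unique_of_mem_Ioo (v := schrodingerField V) (s := fun _ => univ)
      (K := K) (f := fun s => (u s, ∫ y in Iic s, V y * u y)) (g := fun s => (U s, deriv U s))
      (a := a) (b := A) (t₀ := A - 1)
      (fun τ hτ => ((hK τ (Ioo_subset_Icc_self hτ)).1).lipschitzOnWith) ⟨haA, by linarith⟩
      (fun τ hτ => ⟨(hderiv τ hτ.2).prodMk (hP τ), mem_univ _⟩)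
      (fun τ _ => ⟨hU.hasDerivAt_phase τ, mem_univ _⟩) (by simp [hU0, hU1]) ⟨hax, hx⟩
    exact ⟨congrArg Prod.fst key, congrArg Prod.snd key⟩
  refine ⟨U, hU, fun x hx => ?_, fun x hx => ?_, fun x hx => ?_, fun x hx => ?_⟩
  · rw [← (hEq x hx).1]; exact habs x
  · rw [← (hEq x hx).1]; exact hclose x hx.le
  · rw [← (hEq x hx).2]
    refine setIntegral_congr_fun measurableSet_Iic fun y hy => ?_
    rw [(hEq y (lt_of_le_of_lt hy hx)).1]
  · rw [← (hEq x hx).2]; exact hPbd x hx.le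

end Literature.Analysis.ODE
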